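import Summits.Ventures.CertifiedManyBodySolver.Cruxes.ThermalStiffnessCeilingU8b10_le_1o8.SeamCumulantCertificate
import HarnessLib

/-!
# BN-resc-3 — NODE TEMPLATE + PRE-STATED BANDS for the CERT-3×3 seam numbers (hubbard-floor-idea-rescuer g4, 2026-08-28)

WHAT THIS IS: the by-name SHAPE of the certificate node that BN-resc-2 (`SeamCumulantCertificate`, v2, sorry-free) consumes, with the
three enclosures PRE-STATED from this seat's FLOAT pre-statement (in-seat symmetry-blocked exact diagonalisation of the `(3,3)` sector of the
`3×3` torus, `dim 7056 = 3570 ⊕ 3486` under the spin swap, `(t′, U, β·t) = (0, 8, 10)`; second independent code: its direct twisted-spectrum value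
`g₃(0.1)/(β·0.1²) = 0.22542` reproduces idea-4's `fluxg.cpp` `R₃(8) = 0.2254`):
`Re⟨A|_p⟩ = 1.773932`, `Re (A|_p;A|_p)_Duh = 3.218135`, `Re (B|_p;B|_p)_Duh = 0.1320905` (floats, NOT of record), hence
`g₃″(0) = β⟨A⟩ − β²(B;B) = 4.530269`. The bands below (`κlo = 177/100`, `qA = 323/100`, `qB = 133/1000`) are these floats rounded OUTWARD by
`≥ 20×` their expected double-precision error; the generic form `not_k1WithoutTendstoPos_of_bands` records the actual slack: ANY certified triple with
`13/10 ≤ 5κlo − 50qB` (float value `2.265`) and `qA ≤ 144` decides (and `qA ≤ 144` is itself PROVED below: two numbers suffice). A node OF RECORD is written by the engineer who runs the exact (`--tag exact`) kit job: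
rename `cert_k1Sector3_seamNumbers_U8_b10_TEMPLATE ↦ cert_…_<kitid>`, tag it `@[conjecture]`, keep the statement literally, cite the job + PREREG row.

WHAT THIS IS NOT: not a certificate, not a node of record, no kit job behind it; K1 (`ThermalStiffnessCeilingU8b10_le_1o8`) is untouched — only the
junk-free finite-size variant `K1WithoutTendstoPos` is decided GIVEN the node (`chain_readback`); «(3,3) sector of the 3×3 torus» is a particle-number
sector, never a filling word; superconductivity in the Hubbard model is NOT proved by anything here.
-/

open scoped Matrix.Norms.L2Operator ComplexOrder
open Matrix Literature.MathematicalPhysics.QuantumLattice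
open Summit.Ventures.CertifiedManyBodySolver.Observables Summit.Ventures.CertifiedManyBodySolver.Theses
open Summit.Ventures.CertifiedManyBodySolver.Cruxes.ThermalStiffnessCeilingU8b10_le_1o8.Disproof
open Summit.Ventures.CertifiedManyBodySolver.Cruxes.ThermalStiffnessCeilingU8b10_le_1o8.SeamCumulantCertificate

namespace Summit.Ventures.CertifiedManyBodySolver.Cruxes.ThermalStiffnessCeilingU8b10_le_1o8.Cert3x3SeamNumbersTemplate

/-- The three `θ = 0` enclosures BY NAME (untwisted block `H = H^{tt′}(t′=0, U=8, θ=0)|_{k1Sector 3}`, `β·t = 10`):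
`κlo ≤ Re⟨A|_p⟩`, `Re (A|_p;A|_p)_Duh ≤ qA`, `Re (B|_p;B|_p)_Duh ≤ qB`, `A = seamHop 3`, `B = seamCurrent 3`. -/
def SeamNumbersBands3x3 (κlo qA qB : ℝ) : Prop :=
  κlo ≤ (gibbsState 10 ((hubbardTorusTT'Flux 3 0 8 0).toBlock (k1Sector 3) (k1Sector 3))
      ((seamHop 3).toBlock (k1Sector 3) (k1Sector 3))).re ∧
  (duhamel 10 ((hubbardTorusTT'Flux 3 0 8 0).toBlock (k1Sector 3) (k1Sector 3))
      ((seamHop 3).toBlock (k1Sector 3) (k1Sector 3)) ((seamHop 3).toBlock (k1Sector 3) (k1Sector 3))).re ≤ qA ∧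
  (duhamel 10 ((hubbardTorusTT'Flux 3 0 8 0).toBlock (k1Sector 3) (k1Sector 3))
      ((seamCurrent 3).toBlock (k1Sector 3) (k1Sector 3)) ((seamCurrent 3).toBlock (k1Sector 3) (k1Sector 3))).re ≤ qB

/-- NODE SHAPE with the PRE-STATED rationals (floats `1.773932 / 3.218135 / 0.1320905` rounded outward): TEMPLATE, not of record —
the engineer's node `cert_k1Sector3_seamNumbers_U8_b10_<kitid>` is this statement, `@[conjecture]`-tagged, citing the exact kit job. -/
def cert_k1Sector3_seamNumbers_U8_b10_TEMPLATE : Prop :=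
  SeamNumbersBands3x3 (177 / 100) (323 / 100) (133 / 1000)

/-- With the pre-stated bands: the quadratic floor `2·θ² ≤ g₃(θ)` on `|θ| ≤ 10⁻⁹` (BN-resc-2's three-number reduction, norms `4L = 12` proved there). -/
theorem fluxCostQuadFloorAt_of_template (h : cert_k1Sector3_seamNumbers_U8_b10_TEMPLATE) :
    FluxCostQuadFloorAt 3 (1 / 10 ^ 9) 2 :=
  fluxCostQuadFloorAt_of_threeNumbers 3 (κlo := 177 / 100) (qA := 323 / 100) (qB := 133 / 1000) (θ₀ := 1 / 10 ^ 9) (a := 2)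
    (by norm_num) (by norm_num) (by norm_num) (by norm_num) (by norm_num) h.1 h.2.1 h.2.2 (by norm_num)

/-- … and the window of the earlier recommendation, `(θ₀, a) = (10⁻⁸, 3/2)`, also holds with these bands. -/
theorem fluxCostQuadFloorAt_of_template' (h : cert_k1Sector3_seamNumbers_U8_b10_TEMPLATE) :
    FluxCostQuadFloorAt 3 (1 / 10 ^ 8) (3 / 2) :=
  fluxCostQuadFloorAt_of_threeNumbers 3 (κlo := 177 / 100) (qA := 323 / 100) (qB := 133 / 1000) (θ₀ := 1 / 10 ^ 8) (a := 3 / 2)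
    (by norm_num) (by norm_num) (by norm_num) (by norm_num) (by norm_num) h.1 h.2.1 h.2.2 (by norm_num)

/-- … hence the decision of the junk-free finite-size variant (K1 itself untouched). -/
theorem not_k1WithoutTendstoPos_of_template (h : cert_k1Sector3_seamNumbers_U8_b10_TEMPLATE) : ¬ K1WithoutTendstoPos :=
  not_k1WithoutTendstoPos_of_floor (by norm_num) (by norm_num) (fluxCostQuadFloorAt_of_template h)

/-- THE SLACK, generic form: ANY certified triple with `13/10 ≤ 5κlo − 50qB` (float `2.265`), `0 ≤ κlo ≤ 12`, `0 ≤ qB`, `0 ≤ qA ≤ 144 = (4L)²` decides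
(window `θ₀ = 10⁻⁹`, slope `a = 5κlo − 50qB − (cubic-Taylor loss) > 5/4`). This is the tolerance budget for the exact job: `5·δκ + 50·δqB ≤ 0.96`. -/
theorem not_k1WithoutTendstoPos_of_bands {κlo qA qB : ℝ} (h : SeamNumbersBands3x3 κlo qA qB)
    (hκ0 : 0 ≤ κlo) (hκ1 : κlo ≤ 12) (hqA0 : 0 ≤ qA) (hqA1 : qA ≤ 144) (hqB0 : 0 ≤ qB)
    (hgap : 13 / 10 ≤ 5 * κlo - 50 * qB) : ¬ K1WithoutTendstoPos := by
  set a : ℝ := 10 * κlo / 2 - 10 ^ 2 * qB / 2 -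
      (1 / 10 ^ 9) * (5 / 96 * 10 * κlo * (1 / 10 ^ 9) + 10 ^ 2 * qA * (1 / 10 ^ 9) / 8 +
        16 * 10 ^ 3 * ((1 / 10 ^ 9) * (4 * (3 : ℕ)) / 2 + 4 * (3 : ℕ)) ^ 3) with ha_def
  have ha : 5 / 4 < a := by
    rw [ha_def]; push_cast; nlinarith
  exact not_k1WithoutTendstoPos_of_threeNumbers 3 (κlo := κlo) (qA := qA) (qB := qB) (θ₀ := 1 / 10 ^ 9) (a := a)
    (by norm_num) ha (by norm_num) hκ0 hqA0 hqB0 (by norm_num) h.1 h.2.1 h.2.2 (le_of_eq ha_def)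

/-! ## Refinement (v2 of the template): `qA` needs NO certificate — TWO numbers decide

In the window inequality `qA` enters only through `θ₀²·(25/2)·qA`; with `θ₀ = 10⁻⁹` ANY `qA ≤ 144` is harmless, and `Re (A|_p;A|_p)_Duh ≤ ‖A|_p‖² ≤ (4L)² = 144`
is PROVED (tree `Matrix.norm_duhamel_le` + BN-resc-2's `norm_seamHop_toBlock_le`). So the exact job owes only `κlo ≤ Re⟨A|_p⟩` (a Gibbs expectation: one certified
`e^{−βH|_p}` per block) and `Re (B|_p;B|_p)_Duh ≤ qB` (one certified Duhamel/Fréchet block `exp [[−βH, B],[0, −βH]]` per block, or the eigen route). -/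

/-- The TWO certified `θ = 0` enclosures that remain: `κlo ≤ Re⟨A|_p⟩` and `Re (B|_p;B|_p)_Duh ≤ qB`. -/
def SeamNumbersTwo3x3 (κlo qB : ℝ) : Prop :=
  κlo ≤ (gibbsState 10 ((hubbardTorusTT'Flux 3 0 8 0).toBlock (k1Sector 3) (k1Sector 3))
      ((seamHop 3).toBlock (k1Sector 3) (k1Sector 3))).re ∧
  (duhamel 10 ((hubbardTorusTT'Flux 3 0 8 0).toBlock (k1Sector 3) (k1Sector 3))
      ((seamCurrent 3).toBlock (k1Sector 3) (k1Sector 3)) ((seamCurrent 3).toBlock (k1Sector 3) (k1Sector 3))).re ≤ qB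

/-- `Re (A|_p;A|_p)_Duh ≤ 144`, PROVED: `|(X;X)| ≤ ‖X‖²` (tree `Matrix.norm_duhamel_le`) and `‖A|_p‖ ≤ 4·3` (BN-resc-2 `norm_seamHop_toBlock_le`). -/
theorem re_duhamel_seamHop_le_144 :
    (duhamel 10 ((hubbardTorusTT'Flux 3 0 8 0).toBlock (k1Sector 3) (k1Sector 3))
      ((seamHop 3).toBlock (k1Sector 3) (k1Sector 3)) ((seamHop 3).toBlock (k1Sector 3) (k1Sector 3))).re ≤ 144 := by
  haveI := nonempty_k1Sector 3
  have hMh : ((hubbardTorusTT'Flux 3 0 8 0).toBlock (k1Sector 3) (k1Sector 3)).IsHermitian :=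
    (isHermitian_hubbardTorusTT'Flux (L := 3) 0 8 0).submatrix _
  have hn : ‖(seamHop 3).toBlock (k1Sector 3) (k1Sector 3)‖ ≤ 4 * (3 : ℕ) := norm_seamHop_toBlock_le 3 _
  have hn' : ‖(seamHop 3).toBlock (k1Sector 3) (k1Sector 3)‖ ≤ 12 := hn.trans (by norm_num)
  have h := Matrix.norm_duhamel_le hMh (by norm_num : (0 : ℝ) ≤ 10)
    ((seamHop 3).toBlock (k1Sector 3) (k1Sector 3)) ((seamHop 3).toBlock (k1Sector 3) (k1Sector 3))
  have h144 : ‖(seamHop 3).toBlock (k1Sector 3) (k1Sector 3)‖ * ‖(seamHop 3).toBlock (k1Sector 3) (k1Sector 3)‖ ≤ 144 := by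
    nlinarith [norm_nonneg ((seamHop 3).toBlock (k1Sector 3) (k1Sector 3))]
  exact (Complex.re_le_norm _).trans (h.trans h144)

/-- Two numbers give the three-number bands with `qA := 144`. -/
theorem seamNumbersBands_of_two {κlo qB : ℝ} (h : SeamNumbersTwo3x3 κlo qB) : SeamNumbersBands3x3 κlo 144 qB :=
  ⟨h.1, re_duhamel_seamHop_le_144, h.2⟩

/-- **TWO-NUMBER DECISION.** Any certified pair with `0 ≤ κlo ≤ 12`, `0 ≤ qB`, `13/10 ≤ 5κlo − 50qB` (float value `2.265`) decides the junk-free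
finite-size variant in the negative (K1 untouched). Tolerance budget for the exact job: `5·δκ + 50·δqB ≤ 0.96`. -/
theorem not_k1WithoutTendstoPos_of_two {κlo qB : ℝ} (h : SeamNumbersTwo3x3 κlo qB)
    (hκ0 : 0 ≤ κlo) (hκ1 : κlo ≤ 12) (hqB0 : 0 ≤ qB) (hgap : 13 / 10 ≤ 5 * κlo - 50 * qB) : ¬ K1WithoutTendstoPos :=
  not_k1WithoutTendstoPos_of_bands (seamNumbersBands_of_two h) hκ0 hκ1 (by norm_num) (by norm_num) hqB0 hgap

/-- TWO-NUMBER NODE SHAPE with the pre-stated rationals `κlo = 177/100`, `qB = 133/1000` (TEMPLATE, not of record). -/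
def cert_k1Sector3_seamTwoNumbers_U8_b10_TEMPLATE : Prop := SeamNumbersTwo3x3 (177 / 100) (133 / 1000)

theorem not_k1WithoutTendstoPos_of_twoTemplate (h : cert_k1Sector3_seamTwoNumbers_U8_b10_TEMPLATE) : ¬ K1WithoutTendstoPos :=
  not_k1WithoutTendstoPos_of_two h (by norm_num) (by norm_num) (by norm_num) (by norm_num)

end Summit.Ventures.CertifiedManyBodySolver.Cruxes.ThermalStiffnessCeilingU8b10_le_1o8.Cert3x3SeamNumbersTemplate
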